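import Summits.AtomisticToContinuum.HydrodynamicLimit.Theorems.InformationPercolationEngineCollisionRate
import Summits.AtomisticToContinuum.HydrodynamicLimit.Theorems.EvenStressEnskog.Negative.SwappedOrderTrivial

/-!
# `CollisionRate` with the two limits swapped is (junk-)true

Negative knowledge for the crux `InformationPercolationEngine.CollisionRate` (stmt-AtomisticToContinuum-13481), from
the standing disprover's `Cruxes/CollisionRate/Disproof.lean` §1 (cycle 1).  The crux takes `N → ∞` at a fixed
mollification radius `r`, then `r → 0` (`∃ r₀ ∀ r < r₀ ∃ N₀ ∀ N ≥ N₀`).  The statement obtained by SWAPPING the two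
limits (`∃ N₀ ∀ N ≥ N₀ ∃ r₀ ∀ r < r₀`, so that `r₀` may depend on `N`; everything else VERBATIM the route decl) is
PROVED below, for junk reasons, by specialising the sibling crux's lemma
`Theorems.EvenStressEnskog.deviation_eq_zero_of_small_r` (stmt-13079, `Negative/SwappedOrderTrivial.lean`, every
mark `Ξ`) to the constant mark `Ξ ≡ 1` through the bridge `Theorems.CollisionRate.stat_eq_evenStat_one`: at fixed
`N`, once `r ≤ 1`, `2r < ε_N` and `r ≤ 3σ³/(π(N+1)η₀)`,
* the cutoff weight `g(σ³ρ_r(x_i))` read AT a colliding particle vanishes for every particle (the mollified density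
  at a particle contains the particle's own cone mass `3/(πr³(N+1)) ≥ η₀/σ³` — self-smearing), so the collision
  functional `K_N[χ g]` is `0`;
* the Enskog pair functional `B¹_r` vanishes identically on the hard-sphere domain (two distinct spheres, at
  distance `≥ ε_N > 2r`, never share a cone).
Hence `evenStat σ N Φ τ χ g 1 r = 0` on every good orbit (`evenStat_one_eq_zero_of_small_r`) and the deviation
event lies in the Liouville-null bad set of the flow (`collisionRate_swappedOrder`).  MORAL for provers of 13481:
the ORDER of the two limits carries all the content of the crux; no estimate may let `r` depend on `N` (not even
`r_N = ε_N/2`), and in the honest order the self-term `3σ³/(πr³(N+1)) → 0` inside `g`'s argument is what is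
absorbed before `r → 0`.  MORAL for refuters: no counterexample to the crux can come from small `r`.
refuter-cdisprove-stmt-AtomisticToContinuum-13481-0.
-/

noncomputable section

namespace Summit.AtomisticToContinuum.HydrodynamicLimit.Theorems.CollisionRate

open MeasureTheory Filter Set
open scoped ENNReal
open Literature.MathematicalPhysics.KineticTheory Literature.Analysis.FluidPDE

/-- **Both sides of `CollisionRate` vanish at small `r` for fixed `N`.**  Once `r ≤ 1`, `2r < ε_N` and
`r ≤ 3σ³/(π(N+1)η₀)`, on every good orbit the constant-mark statistic `evenStat σ N Φ τ χ g 1 r` (= the crux's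
`D z`, `stat_eq_evenStat_one`) is `0`, for every horizon `τ`, localiser `χ` and cutoff `g` vanishing on `[η₀, ∞)`
(specialisation of `EvenStressEnskog.deviation_eq_zero_of_small_r` to `Ξ ≡ 1`, `Y := contactValue`). [folklore] -/
theorem evenStat_one_eq_zero_of_small_r {N : ℕ} {σ η₀ r : ℝ} (hσ : 0 < σ) (hη₀ : 0 < η₀) (hr : 0 < r)
    (hr1 : r ≤ 1) (hrε : 2 * r < hsDiameter σ N) (hrN : r ≤ 3 * σ ^ 3 / (Real.pi * (N + 1 : ℝ) * η₀))
    (Φ : HardSphereFlow (Torus.geometry (Fin 3)) (hsDiameter σ N) (N + 1)) (τ : ℝ) (χ : ℝ × T3 → ℝ)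
    (g : ℝ → ℝ) (hg0 : ∀ a, η₀ ≤ a → g a = 0) {z : Config (N + 1) (Fin 3) T3} (hz : z ∈ Φ.good) :
    evenStat σ N Φ τ χ g (fun _ => 1) r z = 0 := by
  have h := EvenStressEnskog.deviation_eq_zero_of_small_r hσ hη₀ hr hr1 hrε hrN Φ τ χ g hg0 contactValue
    (fun _ => (1 : ℝ)) hz
  dsimp only [evenStat, Literature.MathematicalPhysics.KineticTheory.collisionSum, enskogRate, pairFunctional,
    mollDensity, coneKernel, sphereMark]
  exact h

/-- **`CollisionRate` with the limit order SWAPPED is (junk-)true.**  The type below is VERBATIM the route decl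
`InformationPercolationEngine.CollisionRate` except that `∃ r₀, 0 < r₀ ∧ ∀ r, 0 < r → r < r₀ → ∃ N₀, ∀ N, N₀ ≤ N →`
is replaced by `∃ N₀, ∀ N, N₀ ≤ N → ∃ r₀, 0 < r₀ ∧ ∀ r, 0 < r → r < r₀ →` (`r → 0` BEFORE `N → ∞`).  Witnesses:
`η₀ := 1`, `σ₀ := 1`, `N₀ := 0`, `r₀(N) := min (min 1 (ε_N/2)) (3σ³/(π(N+1)))`; the deviation event lies in the
Liouville-null bad set of the flow.  So a would-be proof of the crux that is insensitive to the order of the two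
limits proves nothing, and a would-be refutation cannot take `r` small against `N`. [folklore] -/
theorem collisionRate_swappedOrder :
        ∃ η₀ : ℝ, 0 < η₀ ∧ ∀ (a₀ θ₀ : Literature.MathematicalPhysics.KineticTheory.T3 → ℝ) (u₀ : Literature.MathematicalPhysics.KineticTheory.T3 → Literature.MathematicalPhysics.KineticTheory.V3), Continuous a₀ → Continuous θ₀ → Continuous u₀ → (∀ x, 0 < a₀ x) → (∀ x, 0 < θ₀ x) → ∃ σ₀ : ℝ, 0 < σ₀ ∧ ∀ σ : ℝ, 0 < σ → σ < σ₀ → ∀ Φ : (N : ℕ) → Literature.Analysis.FluidPDE.HardSphereFlow (Literature.Analysis.FluidPDE.Torus.geometry (Fin 3)) (Literature.MathematicalPhysics.KineticTheory.hsDiameter σ N) (N + 1), ∀ τ : ℝ, 0 < τ → ∀ χ : ℝ × Literature.MathematicalPhysics.KineticTheory.T3 → ℝ, Continuous χ → ∀ g : ℝ → ℝ, Continuous g → (∀ a, η₀ ≤ a → g a = 0) → ∀ η δ : ℝ, 0 < η → 0 < δ → ∃ N₀ : ℕ, ∀ N : ℕ, N₀ ≤ N → ∃ r₀ : ℝ,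 0 < r₀ ∧ ∀ r : ℝ, 0 < r → r < r₀ → let ε := Literature.MathematicalPhysics.KineticTheory.hsDiameter σ N; let G : Literature.Analysis.FluidPDE.Geometry (Fin 3) Literature.MathematicalPhysics.KineticTheory.T3 := Literature.Analysis.FluidPDE.Torus.geometry (Fin 3); let γ : Literature.Analysis.FluidPDE.Config (N + 1) (Fin 3) Literature.MathematicalPhysics.KineticTheory.T3 → ℝ → Literature.Analysis.FluidPDE.Config (N + 1) (Fin 3) Literature.MathematicalPhysics.KineticTheory.T3 := fun z s => (Φ N).flow s z; let bx : Literature.MathematicalPhysics.KineticTheory.T3 → Literature.MathematicalPhysics.KineticTheory.T3 → ℝ := fun x y => 3 / (Real.pi * r ^ 3) * max (1 - Literature.Analysis.FluidPDE.Torus.euclidDist x y / r) 0; let ρm : Literature.Analysis.FluidPDE.Config (N + 1) (Fin 3) Literature.MathematicalPhysics.KineticTheory.T3 → ℝ → Literature.MathematicalPhysics.KineticTheory.T3 → ℝ := fun z s x₀ => ∫ q, bx q.1 x₀ ∂(Literature.Analysis.FluidPDE.empiricalMeasure (γ z s)); let B1 : Literature.Analysis.FluidPDE.Config (N + 1) (Fin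 3) Literature.MathematicalPhysics.KineticTheory.T3 → ℝ → Literature.MathematicalPhysics.KineticTheory.T3 → ℝ := fun z s x₀ => ∫ p, bx p.1.1 x₀ * bx p.2.1 x₀ * (Real.pi * ‖p.1.2 - p.2.2‖) ∂((Literature.Analysis.FluidPDE.empiricalMeasure (γ z s)).prod (Literature.Analysis.FluidPDE.empiricalMeasure (γ z s))); let Kc : (Literature.Analysis.FluidPDE.Config (N + 1) (Fin 3) Literature.MathematicalPhysics.KineticTheory.T3 → ℝ → Fin (N + 1) → Fin (N + 1) → ℝ) → Literature.Analysis.FluidPDE.Config (N + 1) (Fin 3) Literature.MathematicalPhysics.KineticTheory.T3 → ℝ := fun F z => ε / (N + 1 : ℝ) * ∑ᶠ (s : ℝ) (_ : s ∈ Literature.Analysis.FluidPDE.collisionTimes G ε (γ z) ∩ Set.Icc 0 τ), ∑ i : Fin (N + 1), ∑ j : Fin (N + 1), (if i ≠ j ∧ ‖G.sepVec (γ z s i).1 (γ z s j).1‖ = ε then F z s i j else 0); let Y : ℝ → ℝ := fun a => 3 / (2 * Real.pi) * deriv Literature.MathematicalPhysics.KineticTheory.hsExcessFreeEnergy a; let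 D : Literature.Analysis.FluidPDE.Config (N + 1) (Fin 3) Literature.MathematicalPhysics.KineticTheory.T3 → ℝ := fun z => Kc (fun z s i _ => χ (s, (γ z s i).1) * g (σ ^ 3 * ρm z s (γ z s i).1)) z - σ ^ 3 * ∫ s in Set.Icc (0 : ℝ) τ, ∫ x : Literature.MathematicalPhysics.KineticTheory.T3, χ (s, x) * g (σ ^ 3 * ρm z s x) * Y (σ ^ 3 * ρm z s x) * B1 z s x; Literature.MathematicalPhysics.KineticTheory.localGibbsLaw σ a₀ u₀ θ₀ N (Φ N) {z | η < |D z|} ≤ ENNReal.ofReal δ := by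
  simp only [stat_eq_evenStat_one]
  refine ⟨1, one_pos, fun a₀ θ₀ u₀ _ _ _ _ _ => ⟨1, one_pos, ?_⟩⟩
  intro σ hσ _ Φ τ _ χ _ g _ hg0 η δ hη _
  refine ⟨0, fun N _ => ?_⟩
  have hεpos : 0 < hsDiameter σ N := hsDiameter_pos hσ N
  have hq : 0 < 3 * σ ^ 3 / (Real.pi * (N + 1 : ℝ) * 1) := by positivity
  refine ⟨min (min 1 (hsDiameter σ N / 2)) (3 * σ ^ 3 / (Real.pi * (N + 1 : ℝ) * 1)),
    lt_min (lt_min one_pos (half_pos hεpos)) hq, fun r hr hrlt => ?_⟩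
  have hr1 : r ≤ 1 := (hrlt.le.trans (min_le_left _ _)).trans (min_le_left _ _)
  have hrε : 2 * r < hsDiameter σ N := by
    have := (hrlt.trans_le (min_le_left _ _)).trans_le (min_le_right _ _)
    linarith
  have hrN : r ≤ 3 * σ ^ 3 / (Real.pi * (N + 1 : ℝ) * 1) := hrlt.le.trans (min_le_right _ _)
  have hzero : ∀ z ∈ (Φ N).good, evenStat σ N (Φ N) τ χ g (fun _ => 1) r z = 0 := fun z hz =>
    evenStat_one_eq_zero_of_small_r hσ one_pos hr hr1 hrε hrN (Φ N) τ χ g hg0 hz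
  calc localGibbsLaw σ a₀ u₀ θ₀ N (Φ N) {z | η < |evenStat σ N (Φ N) τ χ g (fun _ => 1) r z|}
      ≤ localGibbsLaw σ a₀ u₀ θ₀ N (Φ N) (Φ N).goodᶜ := by
        refine measure_mono fun z hz' hzg => ?_
        have h0 := hzero z hzg
        simp only [Set.mem_setOf_eq] at hz'
        rw [h0, abs_zero] at hz'
        exact absurd hz' (not_lt.mpr hη.le)
    _ = 0 := EvenStressEnskog.localGibbsLaw_compl_good (Φ N)
    _ ≤ ENNReal.ofReal δ := zero_le

end Summit.AtomisticToContinuum.HydrodynamicLimit.Theorems.CollisionRate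

end
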